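/-
Copyright (c) 2026 the pub-hodgecm-mathlib formalisation cell (harness21).  Prover seat hodgecm-mathlib-B-p14 (g37), 2026-09-01.  «S3-ram» seeding wave (LEAD F0P3a-plan (g12)
T11-50 (1)(b), T11-60 (1); owner p06 (g15); token-second p08 (g18)): RIGID-2-ram III — the depth-one CORNER COLLAR splits into the TWO classes `n(ϖ)`, `n(εϖ)` (cert «S3-ram (iv)» 446431ae).
-/
import Literature.NumberTheory.Automorphic.UnitaryThreeBoundaryRigidityLevelTwoRamifiedRegular   -- ★ file II (this seat, p846886): `exists_levelTwo_conj_near_heisenberg_of_two_deep_of_involution`, `v_corner_trace_le_…_of_isometry`; brings ★ file I, ★ inert currency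
import HarnessLib

/-!
# Boundary rigidity at level two at a TAMELY RAMIFIED place, III: the corner collar — two level-2 classes `n(ϖ)`, `n(εϖ)`, not one (Rogawski 1990 §3.9; Serre, *Local Fields* V §3)

Topic `NumberTheory/Automorphic`; namespace `Literature.NumberTheory.Automorphic.UnitaryGroup`.  THEOREMS ONLY (no definition, no instance, no notation, no named fact, no `sorry`);
kernel lane.  Cell `pub/hodgecm-mathlib` (D-0151), crux H413 = `stmt-HodgeConjecture-24833`; «S3-ram» structure of record (LEAD T11-60 (1)): the ramified head is level-1 in `v`
(= level 2 in `w`, `K₀ ∕ K(ϖ_w²) = O₃(𝔽_q) ⋉ 𝔭`), the LIFT row dissolved into the `𝔭`-layer organs; this file is the `𝔭`-layer CORNER organ of the certificate «S3-ram (iv)»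
(candidate (3)): at local depth ONE the «transvection collar» `x ≡ 1 + ϖ b E₀₂ (mod ϖ²)` carries TWO `K₀`-classes modulo `ϖ²`, `n(ϖ)` and `n(εϖ)` (`ε` a `σ`-fixed unit that is
residually a non-norm ∕ non-square — ★ p846845 `exists_fixed_unit_norm_dichotomy_of_ramified`'s `ε` VERBATIM), and a `γ`-fixed self-dual vertex of a `2`-deep `γ` whose local element
has depth exactly `1` with square-zero leading term lies in EXACTLY ONE of them (certificate: both occur for one `γ` — q = 3: 15∕6 …, q = 5: 20∕10 …, q = 7: 21∕28; selection rule
`t ≡ −S₀[P]`).  SETTING as in files I–II: `σ` an isometric involution of the valued field `K`, residually trivial (`hres`), `ϖ` a uniformiser (at a tame-ramified place `σϖ = −ϖ`, which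
is what makes the normal form `n(tϖ)` itself UNITARY for `σ`-fixed `t`; the theorems below do not use it), `|2| = 1`, `J₀ = antidiag(1,1,1)`, `U = U(σ, J₀)`, `K₀ = U ∩ GL₃(𝒪)`, `n(t) = u(0, t)`.

* §1 **`not_levelTwo_conj_cornerUnipotent_of_nonsquare`** — `n(ϖ)` and `n(εϖ)` are NOT `K₀`-conjugate modulo `ϖ²` (`k n(ϖ) ≡ n(εϖ) k` forces `k₁₀, k₂₀, k₂₁ ∈ 𝔭`, `k₀₀ ≡ εk₂₂`, and
  unitarity `σ(k₀₀)k₂₂ ≡ 1` makes `ε ≡ N(k₂₂⁻¹)` residually — excluded by `hε`).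
* §2 **`levelTwo_conj_cornerUnipotent_of_two_deep_of_neg`** — for `γ` `2`-deep, `g·𝒪³` `γ`-fixed with local element `x` of depth exactly `1` and `(x − 1)² ≡ 0 (mod ϖ³)` (square-zero
  leading term): `x` is `K₀`-conjugate mod `ϖ²` to `n(tϖ)` with `t = 1` or `t = ε` (apartment normal form ★ file II §4 ⇒ `x ~ u(α, β)`, `|α| ≤ |ϖ²|`, `|β| = |ϖ|`; symmetrise
  `b = ½(β∕ϖ + σ(β∕ϖ))`; the `σ`-fixed dichotomy `b = zσz · t` (★ p846845 token `hdich`); torus `d(z⁻¹)`).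

HONEST LABEL: HC_CM is proved only modulo the 2 remaining named inputs (hLiu418 24832, h413 24833) until rung 0 closes; elementary matrix algebra; «S3-ram» = Literature seeding.

## References
* [Rogawski1990] J. D. Rogawski, *Automorphic Representations of Unitary Groups in Three Variables* (1990), §1.10 p. 9, §3.9 p. 32 (the singular classes `t mod N E^×`).
* [Serre1979] J.-P. Serre, *Local Fields*, GTM 67 (1979), Ch. V §3 Prop. 5, Cor. 2 (`U_F ∕ N U_E` of order 2, tame).  [Tits1979] J. Tits, PSPM 33.1 (1979), §3.5.
-/

set_option autoImplicit false

noncomputable section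
open Matrix
open scoped Valued WithZero Matrix MatrixGroups

namespace Literature.NumberTheory.Automorphic.UnitaryGroup
open Literature.NumberTheory.Automorphic Literature.NumberTheory.Automorphic.HermitianLattice Literature.NumberTheory.Automorphic.UnitaryLatticeTree

variable {K : Type*} [Field K] [Valued K ℤᵐ⁰]

/-! ## §1 The two collar classes are distinct modulo `ϖ²` -/

/-- **`n(ϖ)` AND `n(εϖ)` ARE NOT `K₀`-CONJUGATE MODULO `ϖ²`** when `ε` is a unit with `|ε − σz·z| = 1` for all integral `z` (residually not a norm = not a square; ★ p846845's `ε`):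
if `k ∈ K₀` had `k n(ϖ) k⁻¹ ≡ n(εϖ) (mod ϖ²)` then `k n(ϖ) − n(εϖ) k ≡ 0`, i.e. `k₁₀, k₂₀, k₂₁ ∈ 𝔭` and `k₀₀ ≡ ε k₂₂ (mod ϖ)`; the `(0,2)` entry of `ᵗσ(k)J₀k = J₀` then reads
`ε σ(k₂₂) k₂₂ ≡ 1 (mod ϖ)` (`σ` residually trivial), so `ε ≡ σ(z)z` with `z = k₂₂⁻¹` — contradiction.  So the inert one-class statement ★ `levelTwo_conj_cornerUnipotent_of_two_deep`
has no one-class ramified analogue on the collar. [cite: Rogawski1990, §3.9 p. 32] [cite: Serre1979, Ch. V §3] -/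
theorem not_levelTwo_conj_cornerUnipotent_of_nonsquare {σ : K →+* K} {ϖ : K} (hvσ : ∀ z, Valued.v (σ z) = Valued.v z) (hϖ : Valued.v ϖ = WithZero.exp (-1 : ℤ))
    (hres : ∀ x : K, Valued.v x ≤ 1 → Valued.v (σ x - x) < 1)
    {ε : K} (hε : ∀ z : K, Valued.v z ≤ 1 → Valued.v (ε - σ z * z) = 1)
    {n₁ n₂ : GL (Fin 3) K} (hn₁ : (n₁ : Matrix (Fin 3) (Fin 3) K) = !![1, 0, ϖ; 0, 1, 0; 0, 0, 1])
    (hn₂ : (n₂ : Matrix (Fin 3) (Fin 3) K) = !![1, 0, ε * ϖ; 0, 1, 0; 0, 0, 1]) :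
    ¬ ∃ k : GL (Fin 3) K, k ∈ unitaryGroupOfForm σ ((StdForm.antidiagonal 3).over K) ∧ IsIntMatrix (k : Matrix (Fin 3) (Fin 3) K) ∧
        IsIntMatrix ((k⁻¹ : GL (Fin 3) K) : Matrix (Fin 3) (Fin 3) K) ∧
        IsIntMatrix ((ϖ ^ 2)⁻¹ • (((k * n₁ * k⁻¹ : GL (Fin 3) K) : Matrix (Fin 3) (Fin 3) K) - (n₂ : Matrix (Fin 3) (Fin 3) K))) := by
  rintro ⟨k, hkU, hki, -, hc⟩
  have hϖ0 : ϖ ≠ 0 := fun h => by rw [h, map_zero] at hϖ; exact WithZero.zero_ne_coe hϖ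
  have hϖ2 : (ϖ ^ 2 : K) ≠ 0 := pow_ne_zero _ hϖ0
  have hvϖ0 : Valued.v ϖ ≠ 0 := (Valuation.ne_zero_iff _).2 hϖ0
  have hϖ1 : Valued.v ϖ < 1 := by rw [hϖ, ← WithZero.exp_zero, WithZero.exp_lt_exp]; norm_num
  have hεv : Valued.v ε = 1 := by have h := hε 0 (by rw [map_zero]; exact zero_le_one); rwa [mul_zero, sub_zero] at h
  set kM : Matrix (Fin 3) (Fin 3) K := (k : Matrix (Fin 3) (Fin 3) K) with hkM
  -- `k n₁ − n₂ k ≡ 0 (mod ϖ²)`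
  have hD : IsIntMatrix ((ϖ ^ 2)⁻¹ • (kM * !![1, 0, ϖ; 0, 1, 0; 0, 0, 1] - !![1, 0, ε * ϖ; 0, 1, 0; 0, 0, 1] * kM)) := by
    have h : kM * !![1, 0, ϖ; 0, 1, 0; 0, 0, 1] - !![1, 0, ε * ϖ; 0, 1, 0; 0, 0, 1] * kM =
        (((k * n₁ * k⁻¹ : GL (Fin 3) K) : Matrix (Fin 3) (Fin 3) K) - (n₂ : Matrix (Fin 3) (Fin 3) K)) * kM := by
      rw [Units.val_mul, Units.val_mul, hn₁, hn₂, Matrix.sub_mul, Matrix.mul_assoc, Matrix.mul_assoc, Units.inv_mul, Matrix.mul_one]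
    rw [h, ← Matrix.smul_mul]
    exact isIntMatrix_mul hc hki
  rw [isIntMatrix_inv_smul_iff hϖ2] at hD
  -- the entries (1,2), (2,2), (0,2) of `k n₁ − n₂ k`
  have e12 : (kM * !![1, 0, ϖ; 0, 1, 0; 0, 0, 1] - !![1, 0, ε * ϖ; 0, 1, 0; 0, 0, 1] * kM) 1 2 = ϖ * kM 1 0 := by
    rw [Matrix.sub_apply, Matrix.mul_apply, Matrix.mul_apply]; simp [Fin.sum_univ_three]; ring
  have e22 : (kM * !![1, 0, ϖ; 0, 1, 0; 0, 0, 1] - !![1, 0, ε * ϖ; 0, 1, 0; 0, 0, 1] * kM) 2 2 = ϖ * kM 2 0 := by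
    rw [Matrix.sub_apply, Matrix.mul_apply, Matrix.mul_apply]; simp [Fin.sum_univ_three]; ring
  have e02 : (kM * !![1, 0, ϖ; 0, 1, 0; 0, 0, 1] - !![1, 0, ε * ϖ; 0, 1, 0; 0, 0, 1] * kM) 0 2 = ϖ * (kM 0 0 - ε * kM 2 2) := by
    rw [Matrix.sub_apply, Matrix.mul_apply, Matrix.mul_apply]; simp [Fin.sum_univ_three]; ring
  -- `|ϖ·e| ≤ |ϖ²| ⇒ |e| < 1`
  have hsmall : ∀ e : K, Valued.v (ϖ * e) ≤ Valued.v (ϖ ^ 2) → Valued.v e < 1 := fun e he => by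
    rw [map_mul, map_pow, sq] at he
    exact lt_of_le_of_lt (le_of_mul_le_mul_left he (zero_lt_iff.2 hvϖ0)) hϖ1
  have h10 : Valued.v (kM 1 0) < 1 := hsmall _ (by rw [← e12]; exact hD 1 2)
  have h20 : Valued.v (kM 2 0) < 1 := hsmall _ (by rw [← e22]; exact hD 2 2)
  have h00 : Valued.v (kM 0 0 - ε * kM 2 2) < 1 := hsmall _ (by rw [← e02]; exact hD 0 2)
  -- unitarity, pairing of columns `0` and `2`: `σ(k₀₀)k₂₂ + σ(k₁₀)k₁₂ + σ(k₂₀)k₀₂ = 1`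
  have hcol : ∀ j : Fin 3, kM *ᵥ (Pi.single j 1 : Fin 3 → K) = fun i => kM i j := fun j => by
    funext i; simp [Matrix.mulVec, dotProduct, Pi.single_apply]
  have hR : B₀ σ 3 (Pi.single 0 1 : Fin 3 → K) (Pi.single 2 1) = 1 := by rw [B₀_three_apply]; simp
  have hiso := (mem_unitaryGroupOfForm_antidiagonal_iff k).1 hkU (Pi.single 0 1) (Pi.single 2 1)
  rw [← hkM, hcol, hcol, hR, B₀_three_apply] at hiso
  -- `hiso : σ(k₀₀) k₂₂ + σ(k₁₀) k₁₂ + σ(k₂₀) k₀₂ = 1`; put `z = k₂₂`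
  set z : K := kM 2 2 with hz
  have hz1 : Valued.v z ≤ 1 := hki 2 2
  have hσz1 : Valued.v (σ z) ≤ 1 := by rw [hvσ]; exact hz1
  have key : ε * (σ z * z) - 1 =
      (ε - σ ε) * (σ z * z) - σ (kM 0 0 - ε * kM 2 2) * z - σ (kM 1 0) * kM 1 2 - σ (kM 2 0) * kM 0 2 := by
    rw [map_sub, map_mul]
    linear_combination hiso
  have hlt : Valued.v (ε * (σ z * z) - 1) < 1 := by
    rw [key]
    refine lt_of_le_of_lt (Valuation.map_sub _ _ _) (max_lt (lt_of_le_of_lt (Valuation.map_sub _ _ _) (max_lt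
      (lt_of_le_of_lt (Valuation.map_sub _ _ _) (max_lt ?_ ?_)) ?_)) ?_)
    · rw [map_mul, map_mul, ← Valuation.map_neg, neg_sub]
      exact (mul_le_of_le_one_right zero_le (mul_le_one' hσz1 hz1)).trans_lt (hres ε hεv.le)
    · rw [map_mul, hvσ]
      exact (mul_le_of_le_one_right zero_le hz1).trans_lt h00
    · rw [map_mul, hvσ]; exact (mul_le_of_le_one_right zero_le (hki 1 2)).trans_lt h10
    · rw [map_mul, hvσ]; exact (mul_le_of_le_one_right zero_le (hki 0 2)).trans_lt h20
  -- hence `|ε σz z| = 1`, `|z| = 1`, and `ε − σ(z⁻¹) z⁻¹ = (ε σz z − 1)·(σz z)⁻¹` is small: contradiction with `hε z⁻¹`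
  have hN1 : Valued.v (ε * (σ z * z)) = 1 := by
    have h := Valuation.map_eq_of_sub_lt Valued.v (x := (1 : K)) (y := ε * (σ z * z)) (by rw [map_one]; exact hlt)
    rwa [map_one] at h
  have hzv : Valued.v z = 1 := by
    rw [map_mul, map_mul, hεv, hvσ, one_mul] at hN1
    have h0 : Valued.v z ≠ 0 := fun h => by rw [h, mul_zero] at hN1; exact zero_ne_one hN1
    rw [← WithZero.exp_log h0, ← WithZero.exp_add, ← WithZero.exp_zero, WithZero.exp_inj] at hN1
    rw [← WithZero.exp_log h0, ← WithZero.exp_zero, WithZero.exp_inj]; omega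
  have hz0 : z ≠ 0 := fun h => by rw [h, map_zero] at hzv; exact zero_ne_one hzv
  have hσz0 : σ z ≠ 0 := (map_ne_zero σ).2 hz0
  have hzi1 : Valued.v z⁻¹ ≤ 1 := by rw [map_inv₀, hzv, inv_one]
  have hNz : Valued.v (σ z * z) = 1 := by rw [map_mul, hvσ, hzv, one_mul]
  have hfrac : ε - σ z⁻¹ * z⁻¹ = (ε * (σ z * z) - 1) * (σ z * z)⁻¹ := by
    rw [map_inv₀]; field_simp
  have hlt' : Valued.v (ε - σ z⁻¹ * z⁻¹) < 1 := by
    rw [hfrac, map_mul, map_inv₀, hNz, inv_one, mul_one]; exact hlt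
  exact absurd (hε z⁻¹ hzi1) (ne_of_lt hlt')

/-! ## §2 The collar normal form of a fixed vertex: `n(ϖ)` or `n(εϖ)` -/

/-- **THE COLLAR NORMAL FORM (γ-fixed vertices of local depth one).**  `σ` an isometric involution, residually trivial, `ϖ` a uniformiser, `|2| = 1`; `ε` a unit with the
`σ`-fixed dichotomy `hdich` («every non-zero `σ`-fixed `s` is `zσz` or `ε·zσz`», ★ p846845).  Let `γ ∈ U(σ, J₀)` be `2`-deep at `𝒪³`, `g·𝒪³` a `γ`-fixed self-dual vertex whose
local element `x = g⁻¹γg` has depth EXACTLY `1` (`x ≡ 1 (mod ϖ)`, `x ≢ 1 (mod ϖ²)`) with square-zero leading term (`(x − 1)² ≡ 0 (mod ϖ³)`).  Then `x` is `K₀`-conjugate modulo `ϖ²`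
to `n(tϖ)` with `t = 1` or `t = ε` (by §1 not both).  Proof: ★ file II §4 `x ~ y ≡ u(α, β) (mod ϖ²)`; depth `1` gives `|α|, |β| ≤ |ϖ|`; the `(0,2)` entry of `(y − 1)²` is
`−ασα + O(ϖ³)`, so `|α| ≤ |ϖ²|` and `y ≡ n(β) (mod ϖ²)` with `|β| = |ϖ|` (else depth `≥ 2`); `b′ = ½(β∕ϖ + σ(β∕ϖ))` is `σ`-fixed with `n(ϖb′) ≡ n(β)` (`|σb − b| < 1`); `b′ = zσz·t`
and the torus `d(z⁻¹)` carries `n(ϖb′)` to `n(tϖ)` EXACTLY.  (The candidate's `hσϖ : σϖ = −ϖ` is idle and dropped; `hnorm` likewise.)  Certificate «S3-ram (iv)»: both values of `t`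
occur among the fixed vertices of one `γ` (q = 3, 5, 7).
[cite: Rogawski1990, §3.9 p. 32] [cite: Serre1979, Ch. V §3] [cite: Tits1979, §3.5] -/
theorem levelTwo_conj_cornerUnipotent_of_two_deep_of_neg [ValuativeRel K] [(Valued.v : Valuation K ℤᵐ⁰).Compatible]
    {σ : K →+* K} {ϖ : K} (hσ : ∀ x, σ (σ x) = x) (hvσ : ∀ a, Valued.v (σ a) = Valued.v a)
    (hϖ : Valued.v ϖ = WithZero.exp (-1 : ℤ)) (hres : ∀ x : K, Valued.v x ≤ 1 → Valued.v (σ x - x) < 1) (h2 : Valued.v (2 : K) = 1)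
    {ε : K} (hεv : Valued.v ε = 1) (hdich : ∀ s : K, s ≠ 0 → σ s = s → ∃ z : K, z ≠ 0 ∧ (s = z * σ z ∨ s = ε * (z * σ z)))
    {γ g x : GL (Fin 3) K} (hγU : γ ∈ unitaryGroupOfForm σ ((StdForm.antidiagonal 3).over K))
    (hγ2 : IsIntMatrix ((ϖ ^ 2)⁻¹ • ((γ : Matrix (Fin 3) (Fin 3) K) - 1)))
    (hgU : g ∈ unitaryGroupOfForm σ ((StdForm.antidiagonal 3).over K)) (hxg : x = g⁻¹ * γ * g) (hxint : IsIntMatrix (x : Matrix (Fin 3) (Fin 3) K))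
    (hx1 : IsIntMatrix (ϖ⁻¹ • ((x : Matrix (Fin 3) (Fin 3) K) - 1))) (hx2 : ¬ IsIntMatrix ((ϖ ^ 2)⁻¹ • ((x : Matrix (Fin 3) (Fin 3) K) - 1)))
    (hsq : IsIntMatrix ((ϖ ^ 3)⁻¹ • ((x : Matrix (Fin 3) (Fin 3) K) - 1) ^ 2)) :
    ∃ t : K, (t = 1 ∨ t = ε) ∧ ∃ k : GL (Fin 3) K, k ∈ unitaryGroupOfForm σ ((StdForm.antidiagonal 3).over K) ∧ IsIntMatrix (k : Matrix (Fin 3) (Fin 3) K) ∧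
      IsIntMatrix ((k⁻¹ : GL (Fin 3) K) : Matrix (Fin 3) (Fin 3) K) ∧
      IsIntMatrix ((ϖ ^ 2)⁻¹ • (((k * x * k⁻¹ : GL (Fin 3) K) : Matrix (Fin 3) (Fin 3) K) - !![1, 0, t * ϖ; 0, 1, 0; 0, 0, 1])) := by
  have hϖ0 : ϖ ≠ 0 := fun h => by rw [h, map_zero] at hϖ; exact WithZero.zero_ne_coe hϖ
  have hvϖ0 : Valued.v ϖ ≠ 0 := (Valuation.ne_zero_iff _).2 hϖ0
  have hϖ1 : Valued.v ϖ < 1 := by rw [hϖ, ← WithZero.exp_zero, WithZero.exp_lt_exp]; norm_num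
  have hϖv : Valued.v ϖ ≤ 1 := hϖ1.le
  have hϖ2 : (ϖ ^ 2 : K) ≠ 0 := pow_ne_zero _ hϖ0
  have hϖ3 : (ϖ ^ 3 : K) ≠ 0 := pow_ne_zero _ hϖ0
  have hP2e : Valued.v (ϖ ^ 2) = WithZero.exp (-2 : ℤ) := by rw [map_pow, hϖ, sq, ← WithZero.exp_add]; norm_num
  have hP3e : Valued.v (ϖ ^ 3) = WithZero.exp (-3 : ℤ) := by rw [map_pow, hϖ, pow_succ, sq, ← WithZero.exp_add, ← WithZero.exp_add]; norm_num
  have hP21 : Valued.v (ϖ ^ 2) ≤ Valued.v ϖ := by rw [hP2e, hϖ, WithZero.exp_le_exp]; norm_num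
  have hP2P1 : Valued.v (ϖ ^ 2) = Valued.v ϖ * Valued.v ϖ := by rw [map_pow, sq]
  have hP3P : Valued.v (ϖ ^ 3) = Valued.v ϖ * Valued.v (ϖ ^ 2) := by rw [← map_mul, ← pow_succ']
  have h20 : (2 : K) ≠ 0 := fun h => by rw [h, map_zero] at h2; exact zero_ne_one h2
  have hσ2 : σ (2 : K) = 2 := map_ofNat σ 2
  have hlt1 : ∀ z : K, Valued.v z < 1 → Valued.v z ≤ Valued.v ϖ := fun z hz => by rw [hϖ]; exact (v_lt_one_iff z).1 hz
  have hxU : x ∈ unitaryGroupOfForm σ ((StdForm.antidiagonal 3).over K) := by rw [hxg]; exact mul_mem (mul_mem (inv_mem hgU) hγU) hgU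
  -- ★ file II §4: `y = k x k⁻¹ ≡ u(α, β) (mod ϖ²)`
  obtain ⟨k, hkU, hki, hki', α, β, hα1, hβ1, hy⟩ := exists_levelTwo_conj_near_heisenberg_of_two_deep_of_involution hσ hvσ hϖ hγU hγ2 hgU hxg hxint
  set yM : Matrix (Fin 3) (Fin 3) K := ((k * x * k⁻¹ : GL (Fin 3) K) : Matrix (Fin 3) (Fin 3) K) with hyM
  have hyval : yM = (k : Matrix (Fin 3) (Fin 3) K) * (x : Matrix (Fin 3) (Fin 3) K) * ((k⁻¹ : GL (Fin 3) K) : Matrix (Fin 3) (Fin 3) K) := by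
    rw [hyM, Units.val_mul, Units.val_mul]
  have hyE := (isIntMatrix_inv_smul_iff hϖ2 _).1 hy
  obtain ⟨τ, hτ⟩ : ∃ τ : Matrix (Fin 3) (Fin 3) K, yM - !![1, α, β; 0, 1, -σ α; 0, 0, 1] = τ := ⟨_, rfl⟩
  have hτP : ∀ i j, Valued.v (τ i j) ≤ Valued.v (ϖ ^ 2) := by rw [← hτ]; exact hyE
  have hye : ∀ i j, yM i j = !![1, α, β; 0, 1, -σ α; 0, 0, 1] i j + τ i j := fun i j => by rw [← hτ, Matrix.sub_apply]; ring
  -- depth one transported: `y ≡ 1 (mod ϖ)`, so `|α|, |β| ≤ |ϖ|`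
  have hy1 : IsIntMatrix (ϖ⁻¹ • (yM - 1)) := by rw [hyval]; exact isIntMatrix_smul_conj_sub_one _ hki hki' (Units.mul_inv k) hx1
  have hy1E := (isIntMatrix_inv_smul_iff hϖ0 _).1 hy1
  have hαP1 : Valued.v α ≤ Valued.v ϖ := by
    have h : α = (yM 0 1 - (1 : Matrix (Fin 3) (Fin 3) K) 0 1) - τ 0 1 := by rw [hye, Matrix.one_apply_ne (by decide)]; simp
    rw [h]; exact v_sub_le_of_le (by rw [← Matrix.sub_apply]; exact hy1E 0 1) ((hτP 0 1).trans hP21)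
  have hβP1 : Valued.v β ≤ Valued.v ϖ := by
    have h : β = (yM 0 2 - (1 : Matrix (Fin 3) (Fin 3) K) 0 2) - τ 0 2 := by rw [hye, Matrix.one_apply_ne (by decide)]; simp
    rw [h]; exact v_sub_le_of_le (by rw [← Matrix.sub_apply]; exact hy1E 0 2) ((hτP 0 2).trans hP21)
  have hσαP1 : Valued.v (σ α) ≤ Valued.v ϖ := by rw [hvσ]; exact hαP1
  -- square-zero leading term transported: the `(0,2)` entry of `(y − 1)²` is `−ασα + O(ϖ³)`, so `|α| ≤ |ϖ²|`
  have hysq : IsIntMatrix ((ϖ ^ 3)⁻¹ • (yM - 1) ^ 2) := by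
    rw [hyval]; exact isIntMatrix_smul_conj_sub_one_sq _ hki hki' (Units.mul_inv k) (Units.inv_mul k) hsq
  have hysqE := (isIntMatrix_inv_smul_iff hϖ3 _).1 hysq
  have hsq02 : ((yM - 1) ^ 2 : Matrix (Fin 3) (Fin 3) K) 0 2 = τ 0 0 * (β + τ 0 2) + (α + τ 0 1) * (-σ α + τ 1 2) + (β + τ 0 2) * τ 2 2 := by
    rw [sq, Matrix.mul_apply, Fin.sum_univ_three]
    simp only [Matrix.sub_apply, hye, Matrix.one_apply_eq, Matrix.one_apply_ne (show (0 : Fin 3) ≠ 1 by decide),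
      Matrix.one_apply_ne (show (0 : Fin 3) ≠ 2 by decide), Matrix.one_apply_ne (show (1 : Fin 3) ≠ 2 by decide)]
    simp
  have hαα : Valued.v (α * σ α) ≤ Valued.v (ϖ ^ 3) := by
    have h : α * σ α = -((yM - 1) ^ 2 : Matrix (Fin 3) (Fin 3) K) 0 2 + τ 0 0 * (β + τ 0 2) + (α * τ 1 2 - τ 0 1 * σ α + τ 0 1 * τ 1 2) + (β + τ 0 2) * τ 2 2 := by
      rw [hsq02]; ring
    have hβτ : Valued.v (β + τ 0 2) ≤ Valued.v ϖ := v_add_le_of_le hβP1 ((hτP 0 2).trans hP21)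
    rw [h]
    refine v_add_le_of_le (v_add_le_of_le (v_add_le_of_le ?_ ?_) (v_add_le_of_le (v_sub_le_of_le ?_ ?_) ?_)) ?_
    · rw [Valuation.map_neg]; exact hysqE 0 2
    · rw [hP3P, mul_comm (Valued.v ϖ) (Valued.v (ϖ ^ 2))]; exact v_mul_le_mul (hτP 0 0) hβτ
    · rw [hP3P]; exact v_mul_le_mul hαP1 (hτP 1 2)
    · rw [hP3P, mul_comm (Valued.v ϖ) (Valued.v (ϖ ^ 2))]; exact v_mul_le_mul (hτP 0 1) hσαP1
    · rw [hP3P]; exact v_mul_le_mul ((hτP 0 1).trans hP21) (hτP 1 2)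
    · rw [hP3P]; exact v_mul_le_mul hβτ (hτP 2 2)
  have hαP2 : Valued.v α ≤ Valued.v (ϖ ^ 2) := by
    rcases eq_or_ne α 0 with h0 | h0
    · rw [h0, map_zero]; exact zero_le
    · have hv0 : Valued.v α ≠ 0 := (Valuation.ne_zero_iff _).2 h0
      rw [map_mul, hvσ, hP3e, ← WithZero.exp_log hv0, ← WithZero.exp_add, WithZero.exp_le_exp] at hαα
      rw [hP2e, ← WithZero.exp_log hv0, WithZero.exp_le_exp]; omega
  have hσαP2 : Valued.v (-σ α) ≤ Valued.v (ϖ ^ 2) := by rw [Valuation.map_neg, hvσ]; exact hαP2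
  -- `|β| = |ϖ|` exactly (else `y ≡ 1 (mod ϖ²)`, i.e. `x ≡ 1 (mod ϖ²)`)
  have hβP2 : ¬ Valued.v β ≤ Valued.v (ϖ ^ 2) := by
    intro hβ2
    have hyn1 : IsIntMatrix ((ϖ ^ 2)⁻¹ • (yM - 1)) := by
      have hsplit : yM - 1 = (yM - !![1, α, β; 0, 1, -σ α; 0, 0, 1]) + !![0, α, β; 0, 0, -σ α; 0, 0, 0] := by
        rw [sub_add, sub_right_inj]; ext i j; fin_cases i <;> fin_cases j <;> simp
      rw [hsplit, smul_add]
      refine isIntMatrix_add hy ?_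
      rw [isIntMatrix_inv_smul_iff hϖ2]
      intro i j
      fin_cases i <;> fin_cases j <;> first | exact hαP2 | exact hβ2 | exact hσαP2 | simp
    apply hx2
    have h := isIntMatrix_smul_conj_sub_one ((ϖ ^ 2)⁻¹) hki' hki (Units.inv_mul k) hyn1
    rw [hyM, ← Units.val_mul, ← Units.val_mul, show k⁻¹ * (k * x * k⁻¹) * k = x by group] at h
    exact h
  have hβP1' : Valued.v β = Valued.v ϖ := by
    have hβ0 : β ≠ 0 := fun h => hβP2 (by rw [h, map_zero]; exact zero_le)
    have hv0 : Valued.v β ≠ 0 := (Valuation.ne_zero_iff _).2 hβ0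
    rw [hP2e, ← WithZero.exp_log hv0, WithZero.exp_le_exp, not_le] at hβP2
    rw [hϖ, ← WithZero.exp_log hv0, WithZero.exp_le_exp] at hβP1
    rw [hϖ, ← WithZero.exp_log hv0]; congr 1; omega
  -- `b = β∕ϖ`, `b′ = ½(b + σb)`: a `σ`-fixed unit with `|ϖb′ − β| ≤ |ϖ²|`
  obtain ⟨b, hb⟩ : ∃ b : K, β * ϖ⁻¹ = b := ⟨_, rfl⟩
  have hβb : β = ϖ * b := by rw [← hb]; field_simp
  have hbv : Valued.v b = 1 := by
    rw [← hb, map_mul, map_inv₀, hβP1']; exact mul_inv_cancel₀ hvϖ0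
  obtain ⟨b', hb'⟩ : ∃ b' : K, (b + σ b) * (2 : K)⁻¹ = b' := ⟨_, rfl⟩
  have hσb' : σ b' = b' := by rw [← hb', map_mul, map_add, hσ, map_inv₀, hσ2, add_comm]
  have hbb' : Valued.v (b' - b) < 1 := by
    have h : b' - b = (σ b - b) * (2 : K)⁻¹ := by rw [← hb']; field_simp; ring
    rw [h, map_mul, map_inv₀, h2, inv_one, mul_one]; exact hres b hbv.le
  have hb'v : Valued.v b' = 1 := by
    have h := Valuation.map_eq_of_sub_lt Valued.v (x := b) (y := b') (by rw [hbv]; exact hbb')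
    rw [h, hbv]
  have hb'0 : b' ≠ 0 := fun h => by rw [h, map_zero] at hb'v; exact zero_ne_one hb'v
  have hcorner : Valued.v (β - b' * ϖ) ≤ Valued.v (ϖ ^ 2) := by
    rw [hβb, show ϖ * b - b' * ϖ = ϖ * (b - b') by ring, map_mul, Valuation.map_sub_swap, hP2P1]
    exact mul_le_mul_right (hlt1 _ hbb') _
  -- `y ≡ n(ϖ b′) (mod ϖ²)`
  obtain ⟨u, hu, hu'⟩ := exists_units_coe_eq_cornerUnipotent (K := K) (b' * ϖ)
  have hyn : IsIntMatrix ((ϖ ^ 2)⁻¹ • (yM - (u : Matrix (Fin 3) (Fin 3) K))) := by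
    have hsplit : yM - (u : Matrix (Fin 3) (Fin 3) K) = (yM - !![1, α, β; 0, 1, -σ α; 0, 0, 1]) + !![0, α, β - b' * ϖ; 0, 0, -σ α; 0, 0, 0] := by
      rw [hu, sub_add, sub_right_inj]; ext i j; fin_cases i <;> fin_cases j <;> simp
    rw [hsplit, smul_add]
    refine isIntMatrix_add hy ?_
    rw [isIntMatrix_inv_smul_iff hϖ2]
    intro i j
    fin_cases i <;> fin_cases j <;> first | exact hαP2 | exact hcorner | exact hσαP2 | simp
  -- the dichotomy on `b′` and the torus `d(z⁻¹)`
  obtain ⟨z, hz0, hzb⟩ := hdich b' hb'0 hσb'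
  obtain ⟨t, ht, htb⟩ : ∃ t : K, (t = 1 ∨ t = ε) ∧ b' = t * (z * σ z) := by
    rcases hzb with h | h
    · exact ⟨1, Or.inl rfl, by rw [one_mul]; exact h⟩
    · exact ⟨ε, Or.inr rfl, h⟩
  have htv : Valued.v t = 1 := by rcases ht with rfl | rfl <;> [exact map_one _; exact hεv]
  have hzv : Valued.v z = 1 := by
    have h : Valued.v b' = Valued.v t * (Valued.v z * Valued.v z) := by rw [htb, map_mul, map_mul, hvσ]
    rw [hb'v, htv, one_mul] at h
    have hv0 : Valued.v z ≠ 0 := (Valuation.ne_zero_iff _).2 hz0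
    rw [← WithZero.exp_log hv0, ← WithZero.exp_add, ← WithZero.exp_zero, WithZero.exp_inj] at h
    rw [← WithZero.exp_log hv0, ← WithZero.exp_zero, WithZero.exp_inj]; omega
  have hzi0 : z⁻¹ ≠ 0 := inv_ne_zero hz0
  have hσz0 : σ z ≠ 0 := (map_ne_zero σ).2 hz0
  obtain ⟨d, hdd, hdd'⟩ := exists_units_coe_eq_torusElt σ hzi0
  have hdU := torusElt_mem_unitaryGroupOfForm σ hzi0 (hσ _) hdd
  have hdint : IsIntMatrix (d : Matrix (Fin 3) (Fin 3) K) := by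
    rw [hdd]; exact isIntMatrix_diagonal_three (by rw [map_inv₀, hzv, inv_one]) (by rw [map_one]) (by rw [map_inv₀, hvσ, map_inv₀, hzv, inv_one, inv_one])
  have hdint' : IsIntMatrix ((d⁻¹ : GL (Fin 3) K) : Matrix (Fin 3) (Fin 3) K) := by
    rw [hdd']; exact isIntMatrix_diagonal_three (by rw [inv_inv]; exact hzv.le) (by rw [map_one]) (by rw [hvσ, map_inv₀, hzv, inv_one])
  have hconj : (d : Matrix (Fin 3) (Fin 3) K) * (u : Matrix (Fin 3) (Fin 3) K) * ((d⁻¹ : GL (Fin 3) K) : Matrix (Fin 3) (Fin 3) K) = !![1, 0, t * ϖ; 0, 1, 0; 0, 0, 1] := by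
    rw [← Units.val_mul, ← Units.val_mul, coe_torusElt_conj_cornerUnipotent σ hzi0 hdd hdd' hu, htb, map_inv₀]
    congr 1
    ext i j
    fin_cases i <;> fin_cases j <;> simp
    field_simp
  -- assemble `k′ = d k`
  refine ⟨t, ht, d * k, mul_mem hdU hkU, ?_, ?_, ?_⟩
  · rw [Units.val_mul]; exact isIntMatrix_mul hdint hki
  · rw [_root_.mul_inv_rev, Units.val_mul]; exact isIntMatrix_mul hki' hdint'
  · have h := isIntMatrix_smul_conj_sub _ hdint hdint' hyn (T := !![1, 0, t * ϖ; 0, 1, 0; 0, 0, 1])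
      (by rw [hconj, sub_self, smul_zero]; exact isIntMatrix_zero)
    have hval : ((d * k * x * (d * k)⁻¹ : GL (Fin 3) K) : Matrix (Fin 3) (Fin 3) K) =
        (d : Matrix (Fin 3) (Fin 3) K) * yM * ((d⁻¹ : GL (Fin 3) K) : Matrix (Fin 3) (Fin 3) K) := by
      rw [hyM, _root_.mul_inv_rev, show d * k * x * (k⁻¹ * d⁻¹) = d * (k * x * k⁻¹) * d⁻¹ by group]
      simp only [Units.val_mul]
    rw [hval]; exact h

end Literature.NumberTheory.Automorphic.UnitaryGroup

end
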